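import Mathlib
import Summits.AtomisticToContinuum.FouriersLaw.Theses.EmbeddedDrudeMourre
import Summits.AtomisticToContinuum.FouriersLaw.Theorems.EmbeddedDrudeMourreMourreDissolutionRegularLevels
import Summits.AtomisticToContinuum.FouriersLaw.Theorems.EmbeddedDrudeMourreMourreDissolutionPairThresholdB
import HarnessLib

/-!
# Geometry of the free pair resonance for stub B1b″ of line `kinetic-polymer-gas-on-the-time-axis`:
# the critical set of `Ω` on `𝕋³` and the vanishing of the collision bracket on it
(crux `EmbeddedDrudeMourre.DrudeDissolution`, item stmt-AtomisticToContinuum-12593; `--supports` file, closes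
nothing; lead c13, sub-goal M5a of the B1b″ plan)

WHAT. Two elementary inputs of the second-difference estimate B1b″ (`stub_excursionSecondDifference`: Besov
regularity of the bracket-weighted two-phonon density of states `m_f = Ω_*(W dk)`), isolated as registered
sub-goals:

* `resonanceFn_criticalSet` — THE CRITICAL SET OF `Ω(k₁,k₂,k₃) = ω₁ + ω₂ − ω₃ − ω₄` (`k₄ = k₁+k₂−k₃`) ON THE
  TORUS. `∇Ω = 0` says that all four group velocities agree (`∂₁Ω = v₁ − v₄`, `∂₂Ω = v₂ − v₄`, `∂₃Ω = v₄ − v₃`);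
  if they do, then EITHER the point lies on an exchange plane, `k₃ ≡ k₁` or `k₃ ≡ k₂ (mod 2π)` (the co-moving
  curves and the diagonal, critical value `0`), OR it is one of the two isolated extrema `(0,0,π)`, `(π,π,0)`
  `(mod 2π)` (critical values `∓2(ω(π) − ω(0))`). Assembled from the sibling crux's landed `stub_regularLevels`
  (the critical values are `0`, `±2(√(ω₂+4) − √ω₂)`) and `stub_pairThreshold` (level `0` ⇒ exchange planes),
  plus the band-edge rigidity `Ω = ±2(√(ω₂+4) − √ω₂) ⇒ {cos k₁, cos k₂, cos k₃} = {∓1, ∓1, ±1}` proved here.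
* `bracket_abs_le_exchange` / `bracket_abs_le_corner` — THE COLLISION BRACKET VANISHES LINEARLY ON THAT SET:
  for a profile `f` with `|f′| ≤ L`, `[f] = f(k₁) + f(k₂) − f(k₃) − f(k₄)` satisfies
  `|[f]| ≤ 2L|k₃ − k₁ − c|` and `|[f]| ≤ 2L|k₃ − k₂ − c|` for every period `c` of `f` (distance to the exchange
  planes mod the period), and `|[f](k)| ≤ 2L(|k₁ − a₁| + |k₂ − a₂| + |k₃ − a₃|)` whenever `[f](a) = 0` (distance to a
  zero, e.g. the extrema, where `[f](0,0,π) = 2f(0) − f(π) − f(−π) = 0` for odd `f`: `bracket_corner_eq_zero`).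
  Hence the weight `W = Φ²[f]²/(∏ω)²` of `m_f` is `O(dist²)` near the whole critical set — the reason the density
  of states of the pinned chain's odd sector is continuous through every critical value.

HOW. Mean value inequality (`Convex.norm_image_sub_le_of_norm_deriv_le` on `univ`), periodicity, and the
sibling's landed `stub_regularLevels` / `stub_pairThreshold` plus band-edge algebra (`dispersion_sq`).
-/

noncomputable section

open Set Real
open Literature.MathematicalPhysics.KineticTheory
open Literature.MathematicalPhysics.KineticTheory.PhononBoltzmann

namespace Summit.AtomisticToContinuum.FouriersLaw.Theorems.DrudeDissolution.KineticPolymerGasOnTheTimeAxis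

/-! ### Band edges -/

/-- The band lies below its upper edge: `ω(k) ≤ √(ω₂+4)`. [folklore] -/
theorem dispersion_le_sqrt_add_four (ω₂ k : ℝ) : dispersion ω₂ k ≤ Real.sqrt (ω₂ + 4) := by
  unfold dispersion
  apply Real.sqrt_le_sqrt
  have := Real.neg_one_le_cos k
  linarith

/-- Lower band edge rigidity: `ω(k) = √ω₂` forces `cos k = 1` (`ω₂ ≥ 0`). [folklore] -/
theorem cos_eq_one_of_dispersion_eq_sqrt {ω₂ k : ℝ} (hω : 0 ≤ ω₂)
    (h : dispersion ω₂ k = Real.sqrt ω₂) : Real.cos k = 1 := by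
  have h2 : dispersion ω₂ k ^ 2 = Real.sqrt ω₂ ^ 2 := by rw [h]
  rw [dispersion_sq hω, Real.sq_sqrt hω] at h2
  linarith

/-- Upper band edge rigidity: `ω(k) = √(ω₂+4)` forces `cos k = −1` (`ω₂ ≥ 0`). [folklore] -/
theorem cos_eq_neg_one_of_dispersion_eq_sqrt_add_four {ω₂ k : ℝ} (hω : 0 ≤ ω₂)
    (h : dispersion ω₂ k = Real.sqrt (ω₂ + 4)) : Real.cos k = -1 := by
  have h2 : dispersion ω₂ k ^ 2 = Real.sqrt (ω₂ + 4) ^ 2 := by rw [h]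
  rw [dispersion_sq hω, Real.sq_sqrt (by linarith)] at h2
  linarith

/-- **Rigidity of the extremal values of `Ω`.** If `Ω(k₁,k₂,k₃) = 2(√(ω₂+4) − √ω₂)` (the global maximum) then
`cos k₁ = cos k₂ = −1` and `cos k₃ = 1` (the point `(π,π,0)` mod `2π`); if `Ω = −2(√(ω₂+4) − √ω₂)` (the global
minimum) then `cos k₁ = cos k₂ = 1` and `cos k₃ = −1` (the point `(0,0,π)`). [folklore] -/
theorem resonanceFn_extremal_rigidity {ω₂ : ℝ} (hω : 0 ≤ ω₂) (k₁ k₂ k₃ : ℝ) :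
    (resonanceFn ω₂ k₁ k₂ k₃ = 2 * (Real.sqrt (ω₂ + 4) - Real.sqrt ω₂) →
        Real.cos k₁ = -1 ∧ Real.cos k₂ = -1 ∧ Real.cos k₃ = 1) ∧
      (resonanceFn ω₂ k₁ k₂ k₃ = -(2 * (Real.sqrt (ω₂ + 4) - Real.sqrt ω₂)) →
        Real.cos k₁ = 1 ∧ Real.cos k₂ = 1 ∧ Real.cos k₃ = -1) := by
  have l1 := sqrt_le_dispersion (ω₂ := ω₂) k₁
  have l2 := sqrt_le_dispersion (ω₂ := ω₂) k₂
  have l3 := sqrt_le_dispersion (ω₂ := ω₂) k₃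
  have l4 := sqrt_le_dispersion (ω₂ := ω₂) (k₁ + k₂ - k₃)
  have u1 := dispersion_le_sqrt_add_four ω₂ k₁
  have u2 := dispersion_le_sqrt_add_four ω₂ k₂
  have u3 := dispersion_le_sqrt_add_four ω₂ k₃
  have u4 := dispersion_le_sqrt_add_four ω₂ (k₁ + k₂ - k₃)
  constructor
  · intro h
    unfold resonanceFn at h
    refine ⟨cos_eq_neg_one_of_dispersion_eq_sqrt_add_four hω (by linarith),
      cos_eq_neg_one_of_dispersion_eq_sqrt_add_four hω (by linarith),
      cos_eq_one_of_dispersion_eq_sqrt hω (by linarith)⟩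
  · intro h
    unfold resonanceFn at h
    refine ⟨cos_eq_one_of_dispersion_eq_sqrt hω (by linarith),
      cos_eq_one_of_dispersion_eq_sqrt hω (by linarith),
      cos_eq_neg_one_of_dispersion_eq_sqrt_add_four hω (by linarith)⟩

/-! ### The critical set of `Ω` on the torus -/

/-- **Registered sub-goal `resonanceFn_criticalSet` (M5a of stub B1b″): the critical set of the free pair
resonance on `𝕋³`.** For `ω₂ > 0`: if the four group velocities agree,
`v(k₁) = v(k₂) = v(k₃) = v(k₁+k₂−k₃)` (`v = groupVelocity ω₂ = ω′`; equivalently `∇Ω(k₁,k₂,k₃) = 0`, since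
`∂₁Ω = v₁ − v₄`, `∂₂Ω = v₂ − v₄`, `∂₃Ω = v₄ − v₃`), then either `k₃ ≡ k₁ (mod 2π)` or `k₃ ≡ k₂ (mod 2π)` (the
exchange planes: the diagonal and the co-moving curves, critical value `0`), or `cos k₁ = cos k₂ = 1 ∧ cos k₃ = −1`
(the point `(0,0,π)`, the global minimum `−2(ω(π)−ω(0))`), or `cos k₁ = cos k₂ = −1 ∧ cos k₃ = 1` (the point
`(π,π,0)`, the global maximum). [folklore] -/
theorem resonanceFn_criticalSet :
    ∀ ω₂ : ℝ, 0 < ω₂ → ∀ k₁ k₂ k₃ : ℝ,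
      groupVelocity ω₂ k₁ = groupVelocity ω₂ k₂ →
      groupVelocity ω₂ k₂ = groupVelocity ω₂ k₃ →
      groupVelocity ω₂ k₃ = groupVelocity ω₂ (k₁ + k₂ - k₃) →
      (∃ n : ℤ, k₃ = k₁ + 2 * Real.pi * n) ∨ (∃ n : ℤ, k₃ = k₂ + 2 * Real.pi * n) ∨
        (Real.cos k₁ = 1 ∧ Real.cos k₂ = 1 ∧ Real.cos k₃ = -1) ∨
        (Real.cos k₁ = -1 ∧ Real.cos k₂ = -1 ∧ Real.cos k₃ = 1) := by
  intro ω₂ hω k₁ k₂ k₃ h12 h23 h34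
  rcases MourreDissolution.stub_regularLevels ω₂ hω k₁ k₂ k₃ h12 h23 h34 with h0 | hE
  · rcases MourreDissolution.stub_pairThreshold ω₂ hω k₁ k₂ k₃ h0 h12 h23 h34 with h | h
    · exact Or.inl h
    · exact Or.inr (Or.inl h)
  · have hrig := resonanceFn_extremal_rigidity hω.le k₁ k₂ k₃
    rcases (abs_eq (by
        have := Real.sqrt_le_sqrt (le_of_lt (show ω₂ < ω₂ + 4 by linarith))
        linarith)).1 hE with h | h
    · exact Or.inr (Or.inr (Or.inr (hrig.1 h)))
    · exact Or.inr (Or.inr (Or.inl (hrig.2 h)))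

/-! ### The collision bracket vanishes linearly on the critical set -/

/-- Mean value inequality on the line: `|f x − f y| ≤ L|x − y|` when `|f′| ≤ L` everywhere. [folklore] -/
theorem abs_sub_le_of_deriv_bound {f f' : ℝ → ℝ} {L : ℝ} (hf : ∀ x, HasDerivAt f (f' x) x)
    (hL : ∀ x, |f' x| ≤ L) (x y : ℝ) : |f x - f y| ≤ L * |x - y| := by
  have hdiff : ∀ z ∈ (Set.univ : Set ℝ), DifferentiableAt ℝ f z := fun z _ => (hf z).differentiableAt
  have hbound : ∀ z ∈ (Set.univ : Set ℝ), ‖deriv f z‖ ≤ L := fun z _ => by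
    rw [(hf z).deriv, Real.norm_eq_abs]
    exact hL z
  have h := convex_univ.norm_image_sub_le_of_norm_deriv_le hdiff hbound (Set.mem_univ y) (Set.mem_univ x)
  rwa [Real.norm_eq_abs, Real.norm_eq_abs] at h

/-- **Registered sub-goal `bracket_abs_le_exchange` (M5a of stub B1b″): the bracket vanishes linearly on the
exchange planes, uniformly.** If `|f′| ≤ L` and `c` is a period of `f` (e.g. `c = 2πn`), then for all `k₁ k₂ k₃`
`|f(k₁) + f(k₂) − f(k₃) − f(k₁+k₂−k₃)| ≤ 2L·|k₃ − k₁ − c|` and `≤ 2L·|k₃ − k₂ − c|`: the collision amplitude is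
`O(dist)` to each exchange plane `k₃ ≡ k₁`, `k₃ ≡ k₂` on the torus, hence the weight `W ∝ [f]²` is `O(dist²)`.
[folklore] -/
theorem bracket_abs_le_exchange :
    ∀ (f f' : ℝ → ℝ) (L c : ℝ), (∀ x, HasDerivAt f (f' x) x) → (∀ x, |f' x| ≤ L) →
      Function.Periodic f c → ∀ k₁ k₂ k₃ : ℝ,
      |f k₁ + f k₂ - f k₃ - f (k₁ + k₂ - k₃)| ≤ 2 * L * |k₃ - k₁ - c| ∧
        |f k₁ + f k₂ - f k₃ - f (k₁ + k₂ - k₃)| ≤ 2 * L * |k₃ - k₂ - c| := by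
  intro f f' L c hf hL hper k₁ k₂ k₃
  have mv := abs_sub_le_of_deriv_bound hf hL
  constructor
  · -- group as `(f k₁ − f (k₃ − c)) − (f k₄ − f (k₂ + c)·)` using the period
    have e3 : f k₃ = f (k₃ - c) := (hper.sub_eq k₃).symm
    have e4 : f (k₁ + k₂ - k₃) = f (k₁ + k₂ - k₃ + c) := (hper (k₁ + k₂ - k₃)).symm
    have h1 := mv k₁ (k₃ - c)
    have h2 := mv (k₁ + k₂ - k₃ + c) k₂
    have ha : |k₁ - (k₃ - c)| = |k₃ - k₁ - c| := by
      rw [show k₁ - (k₃ - c) = -(k₃ - k₁ - c) by ring, abs_neg]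
    have hb : |k₁ + k₂ - k₃ + c - k₂| = |k₃ - k₁ - c| := by
      rw [show k₁ + k₂ - k₃ + c - k₂ = -(k₃ - k₁ - c) by ring, abs_neg]
    rw [ha] at h1
    rw [hb] at h2
    calc |f k₁ + f k₂ - f k₃ - f (k₁ + k₂ - k₃)|
        = |(f k₁ - f (k₃ - c)) - (f (k₁ + k₂ - k₃ + c) - f k₂)| := by
          rw [← e3, ← e4]; ring_nf
      _ ≤ |f k₁ - f (k₃ - c)| + |f (k₁ + k₂ - k₃ + c) - f k₂| := abs_sub _ _
      _ ≤ L * |k₃ - k₁ - c| + L * |k₃ - k₁ - c| := add_le_add h1 h2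
      _ = 2 * L * |k₃ - k₁ - c| := by ring
  · have e3 : f k₃ = f (k₃ - c) := (hper.sub_eq k₃).symm
    have e4 : f (k₁ + k₂ - k₃) = f (k₁ + k₂ - k₃ + c) := (hper (k₁ + k₂ - k₃)).symm
    have h1 := mv k₂ (k₃ - c)
    have h2 := mv (k₁ + k₂ - k₃ + c) k₁
    have ha : |k₂ - (k₃ - c)| = |k₃ - k₂ - c| := by
      rw [show k₂ - (k₃ - c) = -(k₃ - k₂ - c) by ring, abs_neg]
    have hb : |k₁ + k₂ - k₃ + c - k₁| = |k₃ - k₂ - c| := by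
      rw [show k₁ + k₂ - k₃ + c - k₁ = -(k₃ - k₂ - c) by ring, abs_neg]
    rw [ha] at h1
    rw [hb] at h2
    calc |f k₁ + f k₂ - f k₃ - f (k₁ + k₂ - k₃)|
        = |(f k₂ - f (k₃ - c)) - (f (k₁ + k₂ - k₃ + c) - f k₁)| := by
          rw [← e3, ← e4]; ring_nf
      _ ≤ |f k₂ - f (k₃ - c)| + |f (k₁ + k₂ - k₃ + c) - f k₁| := abs_sub _ _
      _ ≤ L * |k₃ - k₂ - c| + L * |k₃ - k₂ - c| := add_le_add h1 h2
      _ = 2 * L * |k₃ - k₂ - c| := by ring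

/-- **The bracket vanishes at the extremal critical points for odd periodic profiles.** If `f` is odd and
`2π`-periodic then `[f](2πn₁, 2πn₂, π + 2πn₃) = 0` and `[f](π + 2πn₁, π + 2πn₂, 2πn₃) = 0` — the collision amplitude
vanishes at `(0,0,π)` and `(π,π,0)` mod `2π`. [folklore] -/
theorem bracket_corner_eq_zero (f : ℝ → ℝ) (hodd : ∀ x, f (-x) = -f x)
    (hper : Function.Periodic f (2 * Real.pi)) (n₁ n₂ n₃ : ℤ) :
    f (2 * Real.pi * n₁) + f (2 * Real.pi * n₂) - f (Real.pi + 2 * Real.pi * n₃) -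
        f (2 * Real.pi * n₁ + 2 * Real.pi * n₂ - (Real.pi + 2 * Real.pi * n₃)) = 0 ∧
      f (Real.pi + 2 * Real.pi * n₁) + f (Real.pi + 2 * Real.pi * n₂) - f (2 * Real.pi * n₃) -
        f (Real.pi + 2 * Real.pi * n₁ + (Real.pi + 2 * Real.pi * n₂) - 2 * Real.pi * n₃) = 0 := by
  have h0 : f 0 = 0 := by
    have := hodd 0
    rw [neg_zero] at this
    linarith
  have hz : ∀ n : ℤ, f (2 * Real.pi * n) = 0 := by
    intro n
    have e : 2 * Real.pi * n = 0 + n * (2 * Real.pi) := by ring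
    rw [e, hper.int_mul n 0, h0]
  have hπ : ∀ n : ℤ, f (Real.pi + 2 * Real.pi * n) = f Real.pi := by
    intro n
    have e : Real.pi + 2 * Real.pi * n = Real.pi + n * (2 * Real.pi) := by ring
    rw [e, hper.int_mul n Real.pi]
  have hπ' : f (-Real.pi) = f Real.pi := by
    have := hper (-Real.pi)
    rw [show -Real.pi + 2 * Real.pi = Real.pi by ring] at this
    exact this.symm
  have hoddπ : f Real.pi = 0 := by
    have := hodd Real.pi
    rw [hπ'] at this
    linarith
  constructor
  · have e : 2 * Real.pi * n₁ + 2 * Real.pi * n₂ - (Real.pi + 2 * Real.pi * n₃) =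
        -Real.pi + 2 * Real.pi * ((n₁ + n₂ - n₃ : ℤ) : ℝ) := by push_cast; ring
    rw [e, hz, hz, hπ, show -Real.pi + 2 * Real.pi * ((n₁ + n₂ - n₃ : ℤ) : ℝ) =
      -Real.pi + ((n₁ + n₂ - n₃ : ℤ) : ℝ) * (2 * Real.pi) by ring, hper.int_mul, hπ', hoddπ]
    ring
  · have e : Real.pi + 2 * Real.pi * n₁ + (Real.pi + 2 * Real.pi * n₂) - 2 * Real.pi * n₃ =
        0 + ((n₁ + n₂ - n₃ + 1 : ℤ) : ℝ) * (2 * Real.pi) := by push_cast; ring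
    rw [e, hπ, hπ, hz, hper.int_mul, h0, hoddπ]
    ring

/-- **Registered sub-goal `bracket_abs_le_corner` (M5a of stub B1b″): the bracket vanishes linearly at any of its
zeros.** If `|f′| ≤ L` and `[f](a₁,a₂,a₃) = 0` then
`|[f](k₁,k₂,k₃)| ≤ 2L(|k₁ − a₁| + |k₂ − a₂| + |k₃ − a₃|)`; with `bracket_corner_eq_zero` this is the `O(dist)` bound
at the two extremal critical points `(0,0,π)`, `(π,π,0)` mod `2π` for odd profiles. [folklore] -/
theorem bracket_abs_le_corner :
    ∀ (f f' : ℝ → ℝ) (L : ℝ), (∀ x, HasDerivAt f (f' x) x) → (∀ x, |f' x| ≤ L) →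
      ∀ a₁ a₂ a₃ : ℝ, f a₁ + f a₂ - f a₃ - f (a₁ + a₂ - a₃) = 0 → ∀ k₁ k₂ k₃ : ℝ,
      |f k₁ + f k₂ - f k₃ - f (k₁ + k₂ - k₃)| ≤
        2 * L * (|k₁ - a₁| + |k₂ - a₂| + |k₃ - a₃|) := by
  intro f f' L hf hL a₁ a₂ a₃ ha k₁ k₂ k₃
  have mv := abs_sub_le_of_deriv_bound hf hL
  have hL0 : 0 ≤ L := (abs_nonneg _).trans (hL 0)
  have h1 := mv k₁ a₁
  have h2 := mv k₂ a₂
  have h3 := mv k₃ a₃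
  have h4 := mv (k₁ + k₂ - k₃) (a₁ + a₂ - a₃)
  have h4' : |k₁ + k₂ - k₃ - (a₁ + a₂ - a₃)| ≤ |k₁ - a₁| + |k₂ - a₂| + |k₃ - a₃| := by
    calc |k₁ + k₂ - k₃ - (a₁ + a₂ - a₃)| = |(k₁ - a₁) + (k₂ - a₂) - (k₃ - a₃)| := by ring_nf
      _ ≤ |(k₁ - a₁) + (k₂ - a₂)| + |k₃ - a₃| := abs_sub _ _
      _ ≤ |k₁ - a₁| + |k₂ - a₂| + |k₃ - a₃| := by
          have := abs_add_le (k₁ - a₁) (k₂ - a₂)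
          linarith
  calc |f k₁ + f k₂ - f k₃ - f (k₁ + k₂ - k₃)|
      = |(f k₁ - f a₁) + (f k₂ - f a₂) - (f k₃ - f a₃) - (f (k₁ + k₂ - k₃) - f (a₁ + a₂ - a₃))| := by
        congr 1
        linarith
    _ ≤ |f k₁ - f a₁| + |f k₂ - f a₂| + |f k₃ - f a₃| + |f (k₁ + k₂ - k₃) - f (a₁ + a₂ - a₃)| := by
        have e1 := abs_sub ((f k₁ - f a₁) + (f k₂ - f a₂) - (f k₃ - f a₃))
          (f (k₁ + k₂ - k₃) - f (a₁ + a₂ - a₃))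
        have e2 := abs_sub ((f k₁ - f a₁) + (f k₂ - f a₂)) (f k₃ - f a₃)
        have e3 := abs_add_le (f k₁ - f a₁) (f k₂ - f a₂)
        linarith
    _ ≤ L * |k₁ - a₁| + L * |k₂ - a₂| + L * |k₃ - a₃| +
          L * (|k₁ - a₁| + |k₂ - a₂| + |k₃ - a₃|) := by
        have h4'' := h4.trans (mul_le_mul_of_nonneg_left h4' hL0)
        linarith
    _ = 2 * L * (|k₁ - a₁| + |k₂ - a₂| + |k₃ - a₃|) := by ring

end Summit.AtomisticToContinuum.FouriersLaw.Theorems.DrudeDissolution.KineticPolymerGasOnTheTimeAxis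

end
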